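import Mathlib
import Summits.Ventures.FusionMHD.Models.CerfonFreidbergIterLikeQHalfRay
import Summits.Ventures.FusionMHD.Models.CerfonFreidbergNstxLikeAxis
import HarnessLib

/-!
# Ventures/FusionMHD — Models/CerfonFreidbergNstxLikeQHalfRay.lean: CALCULUS OF THE RAY PROFILE of THE Cerfon–Freidberg
# NSTX-like flux about its magnetic axis — `HasDerivAt` facts for the radial derivative `D_r` and the second ray derivative
# `∂_s D_r`, and joint continuity on boxes (NSTX-like TWIN of `Models/CerfonFreidbergIterLikeQHalfRay.lean`, ★ #117)

HONEST FRAMING (LADDER-GRIDFUSION three columns; CF rung, F2 item R2).  Pure calculus about THE NSTX-like flux of record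
`U = cfSolution 0 coeff` (`Models/CerfonFreidbergNstxLikeAxisCert`); no certificate, no `decide`.  Everything instance-independent is
reused BY NAME: model-7's 11-variable code list `CFIterLike.PolarPanel.gExpr` of `U(X_a + s cos θ, s sin θ; c) − U_a/2` with its reading
`eval_gExpr` and derived list `dExpr` (`Models/CerfonFreidbergIterLikePolarPanel.lean`), and the ITER-like Ray file's closed forms
`UXXc/UXYc/UYYc/F2c` and identifications `gExpr_dom`, `dExpr_eval_eq`, `ddExpr_eval_eq`.  New here: the NSTX-like instance point
`pt θ s = (coeff, X_a, U(X_a,0), θ, s)` of the 11-space and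
* **`hasDerivAt_rayProfile`**: `HasDerivAt (rayProfile U X_a 0 θ) (Drc coeff X_a s θ) s`; **`hasDerivAt_Drc`**:
  `HasDerivAt (s ↦ Drc coeff X_a s θ) (F2c coeff X_a s θ) s` (both for `X = X_a + s cos θ > 0`);
* `continuousOn_rayProfile_box` / `continuousOn_Drc_box`: joint continuity in `(θ, s)` on `[a, b] × [s₁, s₂]` with `0 ≤ s₁`, `s₂ < 1`
  (`X ≥ X_a − s₂ > 0.26 > 0` since `X_a > 1.268`) — the `hF` / `hDc` hypotheses of model-7's polar-ray glue.
MODELLED: analytic Cerfon–Freidberg family (NSTX-like triple `(39/50, 2, 7/20)`); nothing about a device or stability.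
Typer/prover: gridfusion-model-5 (g8), 2026-08-27.  Citations: Freidberg 2014 §6.6.1 (6.153) [Freidberg2014]; Moore 1979 §4.3 (4.21) [Moore1979].
-/

noncomputable section

open Set
open Literature.Analysis.ODE Literature.Analysis.ODE.FExpr
open Literature.MathematicalPhysics.MHD Literature.MathematicalPhysics.MHD.CerfonFreidberg
open Summit.Ventures.FusionMHD.Models.CFIterLike.PolarPanel (gExpr cOf eval_gExpr dExpr)
open Summit.Ventures.FusionMHD.Models.CFIterLike.QHalf (UXc UYc Drc UXXc UXYc UYYc F2c gExpr_dom dExpr_eval_eq ddExpr_eval_eq)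

namespace Summit.Ventures.FusionMHD.Models.CFNstxLike.QHalf

/-! ## §1 The NSTX-like instance point of the 11-space -/

/-- The point of the 11-space carrying THE NSTX-like instance: `(coeff, X_a, U(X_a,0), θ, s)`. [instance data] -/
def pt (θ ρ : ℝ) : Fin 11 → ℝ := fun i =>
  if h : (i : ℕ) < 7 then axZero ⟨i, by omega⟩
  else if (i : ℕ) = 7 then axZero 8
  else if (i : ℕ) = 8 then axZero 17
  else if (i : ℕ) = 9 then θ else ρ

/-- Its coefficient part is `CFNstxLike.coeff`. [instance data] -/
theorem cOf_pt (θ ρ : ℝ) : cOf (CFNstxLike.QHalf.pt θ ρ) = coeff := by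
  funext k
  fin_cases k <;> simp [cOf, pt, coeff, axCoeffs, axProj, coeffs]

/-- READING at the NSTX-like instance: `G(pt θ ρ) = U(X_a + ρ cos θ, ρ sin θ) − U(X_a, 0)/2`. [instance data] -/
theorem eval_pt (θ ρ : ℝ) :
    gExpr.eval (CFNstxLike.QHalf.pt θ ρ) = U (Xa + ρ * Real.cos θ) (ρ * Real.sin θ) - ((1 / 2) : ℝ) * U Xa 0 := by
  rw [eval_gExpr, cOf_pt, U_axis]
  rfl

/-- The ray profile of the NSTX-like `U` about the axis is `G + U(X_a,0)/2` along `ρ`. [instance data] -/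
theorem rayProfile_eq (θ ρ : ℝ) :
    PolarRay.rayProfile U Xa 0 θ ρ = gExpr.eval (CFNstxLike.QHalf.pt θ ρ) + ((1 / 2) : ℝ) * U Xa 0 := by
  rw [eval_pt]
  unfold PolarRay.rayProfile
  rw [zero_add]
  ring

/-- Updating the radius coordinate of `pt θ s` gives `pt θ r`. [instance data] -/
theorem update_pt (θ s r : ℝ) : Function.update (CFNstxLike.QHalf.pt θ s) 10 r = pt θ r := by
  funext i
  fin_cases i <;> simp [pt, Function.update]

/-- Coordinates 7, 9, 10 of the NSTX-like instance point `pt θ s`. -/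
theorem pt_coords (θ s : ℝ) : CFNstxLike.QHalf.pt θ s 7 = Xa ∧ pt θ s 9 = θ ∧ pt θ s 10 = s := by
  refine ⟨?_, ?_, ?_⟩ <;> simp [pt, Xa]

/-! ## §2 `HasDerivAt` along the ray -/

/-- **THE RADIAL DERIVATIVE (NSTX-like).**  For `X = X_a + s cos θ > 0`: `HasDerivAt (rayProfile U X_a 0 θ) (Drc coeff X_a s θ) s`. -/
theorem hasDerivAt_rayProfile {θ s : ℝ} (hX : 0 < CFNstxLike.Xa + s * Real.cos θ) :
    HasDerivAt (PolarRay.rayProfile U Xa 0 θ) (Drc coeff Xa s θ) s := by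
  obtain ⟨e7, e9, e10⟩ := pt_coords θ s
  have hdom : gExpr.dom (Function.update (pt θ s) 10 s) := by
    rw [update_pt]; exact gExpr_dom (by rw [e7, e9, e10]; exact hX)
  have hd := hasDerivAt_eval_update 10 (pt θ s) gExpr hdom
  rw [update_pt] at hd
  have hfun : (fun r => gExpr.eval (Function.update (pt θ s) 10 r))
      = fun r => PolarRay.rayProfile U Xa 0 θ r - ((1 / 2) : ℝ) * U Xa 0 := by
    funext r; rw [update_pt, rayProfile_eq]; ring
  rw [hfun] at hd
  have hd' := hd.add_const (((1 / 2) : ℝ) * U Xa 0)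
  simp only [sub_add_cancel] at hd'
  have hv : (gExpr.pderiv 10).eval (pt θ s) = Drc coeff Xa s θ := by
    rw [show gExpr.pderiv 10 = dExpr from rfl, dExpr_eval_eq, cOf_pt, e7, e9, e10]
  rw [hv] at hd'
  exact hd'

/-- **THE SECOND RAY DERIVATIVE (NSTX-like).**  For `X > 0`: `HasDerivAt (s ↦ Drc coeff X_a s θ) (F2c coeff X_a s θ) s`. -/
theorem hasDerivAt_Drc {θ s : ℝ} (hX : 0 < CFNstxLike.Xa + s * Real.cos θ) :
    HasDerivAt (fun r => Drc coeff Xa r θ) (F2c coeff Xa s θ) s := by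
  obtain ⟨e7, e9, e10⟩ := pt_coords θ s
  have hdom : dExpr.dom (Function.update (pt θ s) 10 s) := by
    rw [update_pt]; exact dom_pderiv 10 gExpr (gExpr_dom (by rw [e7, e9, e10]; exact hX))
  have hd := hasDerivAt_eval_update 10 (pt θ s) dExpr hdom
  rw [update_pt] at hd
  have hfun : (fun r => dExpr.eval (Function.update (pt θ s) 10 r)) = fun r => Drc coeff Xa r θ := by
    funext r
    obtain ⟨f7, f9, f10⟩ := pt_coords θ r
    rw [update_pt, dExpr_eval_eq, cOf_pt, f7, f9, f10]
  rw [hfun] at hd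
  have hv : (dExpr.pderiv 10).eval (pt θ s) = F2c coeff Xa s θ := by
    rw [ddExpr_eval_eq _ (by rw [e7, e9, e10]; exact hX.ne'), cOf_pt, e7, e9, e10]
  rw [hv] at hd
  exact hd

/-! ## §3 Joint continuity on boxes `[a, b] × [s₁, s₂]` with `0 ≤ s₁`, `s₂ < 1` -/

/-- On such a box `X = X_a + s cos θ > 0` (NSTX-like: `X_a > 1.268`). -/
theorem X_pos_of_box {θ s s₁ s₂ : ℝ} (h₁ : 0 ≤ s₁) (h₂ : s₂ < 1) (hs : s ∈ Icc s₁ s₂) : 0 < CFNstxLike.Xa + s * Real.cos θ := by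
  have hXa := Xa_bounds.1
  have hc := Real.neg_one_le_cos θ
  have hs0 : 0 ≤ s := h₁.trans hs.1
  nlinarith [hs.2]

/-- The NSTX-like instance-point map `(θ, s) ↦ pt θ s` is continuous. -/
theorem continuous_pt : Continuous (fun p : ℝ × ℝ => CFNstxLike.QHalf.pt p.1 p.2) := by
  refine continuous_pi fun i => ?_
  by_cases hi : (i : ℕ) < 7
  · have e : (fun p : ℝ × ℝ => pt p.1 p.2 i) = fun _ => axZero ⟨i, by omega⟩ := by funext p; simp [pt, hi]
    rw [e]; exact continuous_const
  · by_cases h7 : (i : ℕ) = 7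
    · have e : (fun p : ℝ × ℝ => pt p.1 p.2 i) = fun _ => axZero 8 := by funext p; simp [pt, h7]
      rw [e]; exact continuous_const
    · by_cases h8 : (i : ℕ) = 8
      · have e : (fun p : ℝ × ℝ => pt p.1 p.2 i) = fun _ => axZero 17 := by funext p; simp [pt, h8]
        rw [e]; exact continuous_const
      · by_cases h9 : (i : ℕ) = 9
        · have e : (fun p : ℝ × ℝ => pt p.1 p.2 i) = fun p => p.1 := by funext p; simp [pt, h9]
          rw [e]; exact continuous_fst
        · have e : (fun p : ℝ × ℝ => pt p.1 p.2 i) = fun p => p.2 := by funext p; simp [pt, hi, h7, h8, h9]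
          rw [e]; exact continuous_snd

/-- **Joint continuity of the NSTX-like ray profile** `(θ, s) ↦ U(X_a + s cos θ, s sin θ)` on `[a, b] × [s₁, s₂]`. -/
theorem continuousOn_rayProfile_box {a b s₁ s₂ : ℝ} (h₁ : 0 ≤ s₁) (h₂ : s₂ < 1) :
    ContinuousOn (fun p : ℝ × ℝ => PolarRay.rayProfile CFNstxLike.U Xa 0 p.1 p.2) (Icc a b ×ˢ Icc s₁ s₂) := by
  have hg : ContinuousOn (fun p : ℝ × ℝ => gExpr.eval (pt p.1 p.2)) (Icc a b ×ˢ Icc s₁ s₂) := by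
    refine (contDiffOn_eval gExpr).continuousOn.comp continuous_pt.continuousOn ?_
    intro p hp
    obtain ⟨e7, e9, e10⟩ := pt_coords p.1 p.2
    show gExpr.dom (pt p.1 p.2)
    exact gExpr_dom (by rw [e7, e9, e10]; exact X_pos_of_box h₁ h₂ hp.2)
  have he : ∀ p : ℝ × ℝ, PolarRay.rayProfile U Xa 0 p.1 p.2 = gExpr.eval (pt p.1 p.2) + ((1 / 2) : ℝ) * U Xa 0 :=
    fun p => rayProfile_eq p.1 p.2
  simp_rw [he]
  exact hg.add continuousOn_const

/-- **Joint continuity of the NSTX-like radial-derivative field** `(θ, s) ↦ Drc coeff X_a s θ` on `[a, b] × [s₁, s₂]`. -/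
theorem continuousOn_Drc_box {a b s₁ s₂ : ℝ} (h₁ : 0 ≤ s₁) (h₂ : s₂ < 1) :
    ContinuousOn (fun p : ℝ × ℝ => Drc CFNstxLike.coeff Xa p.2 p.1) (Icc a b ×ˢ Icc s₁ s₂) := by
  have hg : ContinuousOn (fun p : ℝ × ℝ => dExpr.eval (pt p.1 p.2)) (Icc a b ×ˢ Icc s₁ s₂) := by
    refine (contDiffOn_eval dExpr).continuousOn.comp continuous_pt.continuousOn ?_
    intro p hp
    obtain ⟨e7, e9, e10⟩ := pt_coords p.1 p.2
    show dExpr.dom (pt p.1 p.2)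
    exact dom_pderiv 10 gExpr (gExpr_dom (by rw [e7, e9, e10]; exact X_pos_of_box h₁ h₂ hp.2))
  have he : ∀ p : ℝ × ℝ, Drc coeff Xa p.2 p.1 = dExpr.eval (pt p.1 p.2) := by
    intro p
    obtain ⟨e7, e9, e10⟩ := pt_coords p.1 p.2
    rw [dExpr_eval_eq, cOf_pt, e7, e9, e10]
  simp_rw [he]
  exact hg

end Summit.Ventures.FusionMHD.Models.CFNstxLike.QHalf

end
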